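import Mathlib
import HarnessLib
import Summits.Langlands.Langlands.Theses.ParityBlindBianchi
import Summits.Langlands.Langlands.Theses.RuelleTorsionArtinWeight
import Summits.Langlands.Langlands.Theorems.ParityBlindBianchiArtinWeightRealisationLevel
import Summits.Langlands.Langlands.Theorems.ParityBlindBianchiArtinWeightRealisationLevelSharedOfLevel
import Summits.Langlands.Langlands.Theorems.ParityBlindBianchiArtinWeightRealisationLevelInsolubleCore
import Summits.Langlands.Langlands.Theorems.ArtinWeightRealisationLevel.Negative.ZeroSector
import Literature.NumberTheory.Automorphic.PiOfArtinRepAtSigmaUnramifiedPlaces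
import Literature.NumberTheory.Automorphic.CuspidalRepGL2ExistsProofs
import Literature.NumberTheory.Automorphic.GLnAdelicStructureProofs

/-!
# R′ = `ParityBlindBianchi.ArtinWeightRealisationLevel` (crux stmt-Langlands-15111) after the
discharge of the cusp-form existence fact — line `Sketch`, continuation lead c3 (`--supports`)

The lead composition `artinWeightRealisationLevel_of_artinWeightRealisation : R → hG → hC → R′`
(`ParityBlindBianchiArtinWeightRealisationLevel.lean`) and the equivalence
`artinWeightRealisationLevel_iff_artinWeightRealisation : hG → hC → (R′ ↔ R)` (`…SharedOfLevel`)
carried two classical inputs: `hG`, the σ-unramified shadow of Gelbart 1997 Prop. 4.1 (Literature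
named fact `frobSatakeCompatibleAt_of_isPiOfArtinRep_of_isUnramifiedAt`, still open debt — reduced in
the tree to Chevalley's congruence theorem and the twisted Hecke theory of `GL(2)`,
`Automorphic/PiOfArtinRepChevalleyProofs`), and `hC`, the existence of a cuspidal automorphic
representation of `GL₂` over every number field, consumed only by the degenerate sector `0 ∈ S₀` of
R′ (no good place).  `hC` is now a THEOREM of the tree:
`Literature.NumberTheory.Automorphic.nonempty_cuspidalAutomorphicRepData_two_holds`
(`Automorphic/CuspidalRepGL2ExistsProofs`, the supercusp-form principle of Jacquet–Langlands §16 /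
Gelbart 1975 §10).  This file records the consequences for the crux:

* `satakeFrobCompatibleAt_of_zero_mem` — the degenerate sector of R′ holds UNCONDITIONALLY (for
  `0 ∈ S₀` the instance of R′ at `(K, p, ι, σ, S₀)` is the bare existence of a cuspidal `π` of
  `GL₂(𝔸_K)`, now proved);
* `artinWeightRealisationLevel_iff_zero_not_mem` — R′ is EQUIVALENT to its repaired form (the
  same statement with `0 ∉ S₀` added), unconditionally: the typing defect found by the disprover
  (`Negative/ZeroSector`) no longer carries any content, and the planner need not restate R′;
* `artinWeightRealisationLevel_of_artinWeightRealisation_of_gelbart : R → hG → R′` — the crux BY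
  NAME modulo item stmt-Langlands-11057 and ONE named fact;
* `artinWeightRealisationLevel_iff_artinWeightRealisation_of_gelbart : hG → (R′ ↔ R)` — the two
  cruxes are equivalent modulo Gelbart 4.1 alone;
* `artinWeightRealisationLevel_of_artinWeightRealisation_insoluble_of_gelbart :
  LT → hG → R|icosahedral → R′` — the common icosahedral core (`…InsolubleCore`) with `hC` gone.

Conditional set of the line after this file: {item stmt-Langlands-11057 (the open core R, equivalently
its icosahedral sector modulo Langlands–Tunnell), `hG`}.  No definitions.
-/

noncomputable section

open scoped BigOperators Topology Classical Matrix NumberField MatrixGroups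
open Literature.NumberTheory.Automorphic Literature.NumberTheory.GaloisRepresentations
  IsDedekindDomain NumberField Filter

-- `Summit.Langlands.Langlands.…`: summit = sub-problem name (D-0017 nested layout), not a typo.
set_option linter.dupNamespace false

namespace Summit.Langlands.Langlands.Theorems.ArtinWeightRealisationLevel

/-- **The degenerate sector of R′ holds unconditionally.**  If `0 ∈ S₀` then no finite place of
`K` is good (`(0 : 𝓞 K)` lies in every prime), so the instance of
`ParityBlindBianchi.ArtinWeightRealisationLevel` at `(K, p, ι, σ, S₀)` — whatever the hypothesis
package — asks only for a cuspidal automorphic representation of `GL₂(𝔸_K)`, which exists by the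
tree's theorem `nonempty_cuspidalAutomorphicRepData_two_holds` (Jacquet–Langlands §16 / Gelbart 1975
Thm. 7.11, proved in `Automorphic/CuspidalRepGL2ExistsProofs`), typed by the compactness theorem
`isCompact_glFiniteIntegralLevel_holds 2 K`. [folklore] -/
theorem satakeFrobCompatibleAt_of_zero_mem (K : Type) [Field K] [NumberField K] (p : ℕ)
    [Fact p.Prime] (ι : PadicAlgCl p ≃+* ℂ) (σ : FramedGaloisRep K (PadicAlgCl p) 2)
    (S₀ : Finset ℕ) (h0 : (0 : ℕ) ∈ S₀) :
    ∃ (hcpt : isCompact_glFiniteIntegralLevel 2 K) (π : CuspidalAutomorphicRepData 2 K hcpt),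
      ∀ w : HeightOneSpectrum (𝓞 K), (∀ ℓ ∈ S₀, ((ℓ : ℕ) : 𝓞 K) ∉ w.asIdeal) →
        Summit.Langlands.SatakeFrobCompatibleAt ι π.1 σ w :=
  Negative.instance_of_zero_mem_of_cuspForms K p ι σ S₀ h0
    ⟨isCompact_glFiniteIntegralLevel_holds 2 K,
      nonempty_cuspidalAutomorphicRepData_two_holds K (isCompact_glFiniteIntegralLevel_holds 2 K)⟩

/-- **R′ is equivalent to its repaired form, unconditionally.**
`ParityBlindBianchi.ArtinWeightRealisationLevel` (stmt-Langlands-15111, `S₀ : Finset ℕ` with the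
single side condition `p ∈ S₀`) is equivalent to the same statement with `0 ∉ S₀` added after
`p ∈ S₀` (the intended statement: every `ℓ ∈ S₀` then has finitely many places above it).
`→` is restriction; `←` splits on `0 ∈ S₀` and settles the degenerate sector by
`satakeFrobCompatibleAt_of_zero_mem`.  (The disprover's `Negative/ZeroSector` showed that R′ as
typed FORCES the existence of a Bianchi cusp form; that conjunct is now a theorem, so the typing
defect is harmless.) [folklore] -/
theorem artinWeightRealisationLevel_iff_zero_not_mem : Summit.Langlands.Langlands.Theses.ParityBlindBianchi.ArtinWeightRealisationLevel ↔ (∀ (K : Type) [Field K] [NumberField K], NumberField.IsTotallyComplex K → Module.finrank ℚ K = 2 → ∀ (p : ℕ) [Fact p.Prime] (ι : PadicAlgCl p ≃+* ℂ) (σ : Literature.NumberTheory.GaloisRepresentations.FramedGaloisRep K (PadicAlgCl p) 2), Finite σ.toMonoidHom.range → σ.toGaloisRep.IsIrreducible → ∀ S₀ : Finset ℕ, p ∈ S₀ → 0 ∉ S₀ → (∃ (U : Subgroup (GL (Fin 2) (IsDedekindDomain.FiniteAdeleRing (NumberField.RingOfIntegers K) K))) (ϖ : ∀ v : IsDedekindDomain.HeightOneSpectrum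 (NumberField.RingOfIntegers K), (v.adicCompletion K)ˣ) (a : {v : IsDedekindDomain.HeightOneSpectrum (NumberField.RingOfIntegers K) // ∀ ℓ ∈ S₀, ((ℓ : ℕ) : NumberField.RingOfIntegers K) ∉ v.asIdeal} → ℕ → (Valued.v (R := PadicAlgCl p)).valuationSubring), IsOpen (U : Set (GL (Fin 2) (IsDedekindDomain.FiniteAdeleRing (NumberField.RingOfIntegers K) K))) ∧ U ≤ Literature.NumberTheory.Automorphic.glFiniteIntegralLevel 2 K ∧ (∀ g ∈ Literature.NumberTheory.Automorphic.glFiniteIntegralLevel 2 K, (∀ v : IsDedekindDomain.HeightOneSpectrum (NumberField.RingOfIntegers K), ¬ (∀ ℓ ∈ S₀, ((ℓ : ℕ) : NumberField.RingOfIntegers K) ∉ v.asIdeal) → ∀ i j : Fin 2, ((g : Matrix (Fin 2) (Fin 2) (IsDedekindDomain.FiniteAdeleRing (NumberField.RingOfIntegers K) K)) i j) v = (1 : Matrix (Fin 2) (Fin 2) (v.adicCompletion K)) i j) → g ∈ U) ∧ (∀ v : IsDedekindDomain.HeightOneSpectrum (NumberField.RingOfIntegers K), Valued.v ((ϖ v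 : (v.adicCompletion K)ˣ) : v.adicCompletion K) = WithZero.exp (-1 : ℤ)) ∧ Literature.NumberTheory.Automorphic.IsHeckePoint (Matrix.GeneralLinearGroup.map (n := Fin 2) (algebraMap K (IsDedekindDomain.FiniteAdeleRing (NumberField.RingOfIntegers K) K))) (Literature.NumberTheory.Automorphic.LevelTower.ofSeq U (fun r : ℕ => (Literature.NumberTheory.Automorphic.principalCongruenceLevel 2 K (Ideal.span {((p : ℕ) : NumberField.RingOfIntegers K)} ^ r)).map (Literature.NumberTheory.Automorphic.GLn.sndHom 2 K))) ((p : ℕ) : (Valued.v (R := PadicAlgCl p)).valuationSubring) (fun j : {v : IsDedekindDomain.HeightOneSpectrum (NumberField.RingOfIntegers K) // ∀ ℓ ∈ S₀, ((ℓ : ℕ) : NumberField.RingOfIntegers K) ∉ v.asIdeal} × Fin 2 => Literature.NumberTheory.Automorphic.GLn.sndHom 2 K (Literature.NumberTheory.Automorphic.heckeDiagAt 2 K j.1.1 (ϖ j.1.1) (j.2.val + 1))) (fun j => a j.1 (j.2.val + 1)) ∧ ∀ (v : IsDedekindDomain.HeightOneSpectrum (NumberField.RingOfIntegers K)) (hv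 : ∀ ℓ ∈ S₀, ((ℓ : ℕ) : NumberField.RingOfIntegers K) ∉ v.asIdeal), σ.IsHeckeAssociatedAt v (fun i : ℕ => if i = 0 then (1 : PadicAlgCl p) else ((a ⟨v, hv⟩ i : (Valued.v (R := PadicAlgCl p)).valuationSubring) : PadicAlgCl p))) → ∃ (hcpt : Literature.NumberTheory.Automorphic.isCompact_glFiniteIntegralLevel 2 K) (π : Literature.NumberTheory.Automorphic.CuspidalAutomorphicRepData 2 K hcpt), ∀ w : IsDedekindDomain.HeightOneSpectrum (NumberField.RingOfIntegers K), (∀ ℓ ∈ S₀, ((ℓ : ℕ) : NumberField.RingOfIntegers K) ∉ w.asIdeal) → Summit.Langlands.SatakeFrobCompatibleAt ι π.1 σ w) := by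
  constructor
  · intro h K _ _ htc hdeg p _ ι σ hfin hirr S₀ hp _ hyp
    exact h K htc hdeg p ι σ hfin hirr S₀ hp hyp
  · intro h K _ _ htc hdeg p _ ι σ hfin hirr S₀ hp hyp
    by_cases h0 : (0 : ℕ) ∈ S₀
    · exact satakeFrobCompatibleAt_of_zero_mem K p ι σ S₀ h0
    · exact h K htc hdeg p ι σ hfin hirr S₀ hp h0 hyp

/-- **R′ from R modulo ONE named fact (the crux BY NAME).**
`ParityBlindBianchi.ArtinWeightRealisationLevel` (stmt-Langlands-15111) follows from
`RuelleTorsionArtinWeight.ArtinWeightRealisation` (item stmt-Langlands-11057) and the σ-unramified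
shadow of Gelbart 1997 Prop. 4.1 (`frobSatakeCompatibleAt_of_isPiOfArtinRep_of_isUnramifiedAt`,
Literature named fact); the cusp-form existence input of
`artinWeightRealisationLevel_of_artinWeightRealisation` is discharged by
`nonempty_cuspidalAutomorphicRepData_two_holds`. [folklore] -/
theorem artinWeightRealisationLevel_of_artinWeightRealisation_of_gelbart : Summit.Langlands.Langlands.Theses.RuelleTorsionArtinWeight.ArtinWeightRealisation → Literature.NumberTheory.Automorphic.frobSatakeCompatibleAt_of_isPiOfArtinRep_of_isUnramifiedAt → Summit.Langlands.Langlands.Theses.ParityBlindBianchi.ArtinWeightRealisationLevel :=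
  fun hR hG => artinWeightRealisationLevel_of_artinWeightRealisation hR
    (fun hcpt σ π hπ v hv => hG hcpt σ π hπ v hv)
    (fun F _ _ hF => nonempty_cuspidalAutomorphicRepData_two_holds F hF)

/-- **The two cruxes are equivalent modulo Gelbart 1997 Prop. 4.1 alone.**  Under the
σ-unramified shadow `frobSatakeCompatibleAt_of_isPiOfArtinRep_of_isUnramifiedAt`,
`ParityBlindBianchi.ArtinWeightRealisationLevel` (stmt-Langlands-15111) and
`RuelleTorsionArtinWeight.ArtinWeightRealisation` (stmt-Langlands-11057) are equivalent
(`→` unconditional, `artinWeightRealisation_of_artinWeightRealisationLevel`; `←` the previous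
theorem). [folklore] -/
theorem artinWeightRealisationLevel_iff_artinWeightRealisation_of_gelbart : Literature.NumberTheory.Automorphic.frobSatakeCompatibleAt_of_isPiOfArtinRep_of_isUnramifiedAt → (Summit.Langlands.Langlands.Theses.ParityBlindBianchi.ArtinWeightRealisationLevel ↔ Summit.Langlands.Langlands.Theses.RuelleTorsionArtinWeight.ArtinWeightRealisation) :=
  fun hG => ⟨artinWeightRealisation_of_artinWeightRealisationLevel,
    fun hR => artinWeightRealisationLevel_of_artinWeightRealisation_of_gelbart hR hG⟩

/-- **R′ (BY NAME) from the icosahedral sector of the shared crux R, modulo Langlands–Tunnell and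
Gelbart 4.1 only.**  `strongArtin_of_isSolvable` settles the solvable sector of R
(`artinWeightRealisation_of_insoluble_sector`, `…InsolubleCore`), Gelbart's σ-shadow upgrades a.e.
compatibility to every good place, and the cusp-form existence input of
`artinWeightRealisationLevel_of_artinWeightRealisation_insoluble` is discharged by
`nonempty_cuspidalAutomorphicRepData_two_holds`.  The third hypothesis is the statement of R with
`¬ IsSolvable (projectiveImage σ.toMonoidHom)` inserted after irreducibility (nothing is claimed
about it: it is the open core). [folklore] -/
theorem artinWeightRealisationLevel_of_artinWeightRealisation_insoluble_of_gelbart : Literature.NumberTheory.Automorphic.strongArtin_of_isSolvable → Literature.NumberTheory.Automorphic.frobSatakeCompatibleAt_of_isPiOfArtinRep_of_isUnramifiedAt → (∀ (K : Type) [Field K] [NumberField K], NumberField.IsTotallyComplex K → Module.finrank ℚ K = 2 → ∀ (p : ℕ) [Fact p.Prime] (ι : PadicAlgCl p ≃+* ℂ) (σ : Literature.NumberTheory.GaloisRepresentations.FramedGaloisRep K (PadicAlgCl p) 2), Finite σ.toMonoidHom.range → σ.toGaloisRep.IsIrreducible → ¬ IsSolvable (Literature.NumberTheory.GaloisRepresentations.projectiveImage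 σ.toMonoidHom) → (∃ (S : Finset (IsDedekindDomain.HeightOneSpectrum (NumberField.RingOfIntegers K))) (U : Subgroup (GL (Fin 2) (IsDedekindDomain.FiniteAdeleRing (NumberField.RingOfIntegers K) K))) (ϖ : ∀ v : IsDedekindDomain.HeightOneSpectrum (NumberField.RingOfIntegers K), (v.adicCompletion K)ˣ) (a : {v : IsDedekindDomain.HeightOneSpectrum (NumberField.RingOfIntegers K) // v ∉ S} → ℕ → (Valued.v (R := PadicAlgCl p)).valuationSubring), (∀ v : IsDedekindDomain.HeightOneSpectrum (NumberField.RingOfIntegers K), ((p : ℕ) : NumberField.RingOfIntegers K) ∈ v.asIdeal → v ∈ S) ∧ IsOpen (U : Set (GL (Fin 2) (IsDedekindDomain.FiniteAdeleRing (NumberField.RingOfIntegers K) K))) ∧ U ≤ Literature.NumberTheory.Automorphic.glFiniteIntegralLevel 2 K ∧ (∀ g ∈ Literature.NumberTheory.Automorphic.glFiniteIntegralLevel 2 K, (∀ v ∈ S, ∀ i j : Fin 2, ((g : Matrix (Fin 2) (Fin 2) (IsDedekindDomain.FiniteAdeleRing (NumberField.RingOfIntegers K) K)) i j) v = (1 :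 Matrix (Fin 2) (Fin 2) (v.adicCompletion K)) i j) → g ∈ U) ∧ (∀ v : IsDedekindDomain.HeightOneSpectrum (NumberField.RingOfIntegers K), Valued.v ((ϖ v : (v.adicCompletion K)ˣ) : v.adicCompletion K) = WithZero.exp (-1 : ℤ)) ∧ Literature.NumberTheory.Automorphic.IsHeckePoint (Matrix.GeneralLinearGroup.map (n := Fin 2) (algebraMap K (IsDedekindDomain.FiniteAdeleRing (NumberField.RingOfIntegers K) K))) (Literature.NumberTheory.Automorphic.LevelTower.ofSeq U (fun r : ℕ => (Literature.NumberTheory.Automorphic.principalCongruenceLevel 2 K (Ideal.span {((p : ℕ) : NumberField.RingOfIntegers K)} ^ r)).map (Literature.NumberTheory.Automorphic.GLn.sndHom 2 K))) ((p : ℕ) : (Valued.v (R := PadicAlgCl p)).valuationSubring) (fun j : {v : IsDedekindDomain.HeightOneSpectrum (NumberField.RingOfIntegers K) // v ∉ S} × Fin 2 => Literature.NumberTheory.Automorphic.GLn.sndHom 2 K (Literature.NumberTheory.Automorphic.heckeDiagAt 2 K j.1.1 (ϖ j.1.1) (j.2.val + 1))) (fun j => a j.1 (j.2.val + 1)) ∧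 ∀ (v : IsDedekindDomain.HeightOneSpectrum (NumberField.RingOfIntegers K)) (hv : v ∉ S), σ.IsHeckeAssociatedAt v (fun i : ℕ => if i = 0 then (1 : PadicAlgCl p) else ((a ⟨v, hv⟩ i : (Valued.v (R := PadicAlgCl p)).valuationSubring) : PadicAlgCl p))) → ∃ (hcpt : Literature.NumberTheory.Automorphic.isCompact_glFiniteIntegralLevel 2 K) (π : Literature.NumberTheory.Automorphic.CuspidalAutomorphicRepData 2 K hcpt), ∀ᶠ w : IsDedekindDomain.HeightOneSpectrum (NumberField.RingOfIntegers K) in Filter.cofinite, Summit.Langlands.SatakeFrobCompatibleAt ι π.1 σ w) → Summit.Langlands.Langlands.Theses.ParityBlindBianchi.ArtinWeightRealisationLevel :=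
  fun hLT hG hcore => artinWeightRealisationLevel_of_artinWeightRealisation_insoluble hLT
    (fun hcpt σ π hπ v hv => hG hcpt σ π hπ v hv)
    (fun F _ _ hF => nonempty_cuspidalAutomorphicRepData_two_holds F hF) hcore

end Summit.Langlands.Langlands.Theorems.ArtinWeightRealisationLevel

end
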